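import Mathlib
import Summits.ValiantsHypothesis.ValiantsHypothesis.Theorems.NewtonUnitEquationsTwoProductsPlanarCellRelationBlocks
import HarnessLib

/-!
# Crux `TwoProducts` (stmt-ValiantsHypothesis-5906): the relation laws at `r = 0` and `r = 1` (binder-shape regression tests)

Helper mode (`--supports stmt-ValiantsHypothesis-5906 --as helper`; val-lit-p3 g14, KEEP lineage; asked by val-neg-1 g1's audit
`NOTE-neg1-5906-R1r-hSR-audit.md` R0/R5 and desk RULING #257 (c)).
* `planarCell_relationClasses_zero`: with NO class (`r = 0`) the hypothesis of `planarCell_relationClasses` is dissociation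
  (`Set.InjOn Σ`) and the bound is `2(m+1)` — the regime of `planarCell_dissociated_linear` (p603804), recovered by name from the
  `r`-class law.
* `planarCell_singleRelation_of_relationClasses`: the single-relation hypothesis (`SingleRelation`, rung R1) is the case `r = 1`:
  `#S ≤ 2(m+1)·3(2+m+C(m,2))²`.
* `planarCell_relationBlocks_zero` / `planarCell_singleRelation_of_relationBlocks`: the same two instances of the per-position law
  `planarCell_relationBlocks`.
Currency remark (val-neg-1 R2): the CLASS form counts templates `(J, {a|J, b|J})`, which do not compose — `q` independent relations on
disjoint blocks realise `(3^q − 1)/2` templates; the per-position BLOCK form (`planarCell_relationBlocks`, p613936) charges such a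
family only `q` blocks.
Honest framing: corollaries of helper laws outside any cone of the OPEN crux line; the residual, `PlanarCellBound`, the crux
`TwoProducts` and `VP ≠ VNP` are OPEN and NOT claimed; no summit statement is proved here.  No instances, no notation, no named
facts. [folklore]
-/

noncomputable section

-- Sub = Summit single-conjunct layout: the duplicated namespace component is mandated by the tree.
set_option linter.dupNamespace false

open scoped BigOperators
open MvPolynomial
open Summit.ValiantsHypothesis.ValiantsHypothesis.Theorems.NewtonUnitEquations.TwoProducts.FormalLogLinearisation

namespace Summit.ValiantsHypothesis.ValiantsHypothesis.Theorems.NewtonUnitEquations.TwoProducts.PlanarCell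

variable {m : ℕ}

/-- **`r = 0` of the class law = the dissociated regime**: `Σ` injective on `∏(A_j ∪ {0})` ⇒ per cell `#S ≤ 2(m+1)`. [folklore] -/
theorem planarCell_relationClasses_zero (u v : Fin m → MvPolynomial (Fin 2) ℂ) (A : Fin m → Finset Expo)
    (hA0 : ∀ j, (0 : Expo) ∉ A j) (huA : ∀ j, (u j).support ⊆ A j) (hvA : ∀ j, (v j).support ⊆ A j)
    (hdis : Set.InjOn (fun a : Fin m → Expo => ∑ j, a j) ↑(tuples A))
    (R : Expo → Expo → Prop) (S : Finset Expo) (hS : IsCellFamily u v R S) :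
    S.card ≤ 2 * (m + 1) := by
  have h := planarCell_relationClasses u v A hA0 huA hvA (r := 0) (fun k => k.elim0) (fun k => k.elim0) (fun k => k.elim0)
    (fun a ha b hb hne hsum => absurd (hdis ha hb hsum) hne) R S hS
  simpa using h

/-- **`r = 1` of the class law = the single-relation law** (rung R1's hypothesis `SingleRelation`, unfolded):
per cell `#S ≤ 2(m+1)·3(2+m+C(m,2))²`. [folklore] -/
theorem planarCell_singleRelation_of_relationClasses (u v : Fin m → MvPolynomial (Fin 2) ℂ) (A : Fin m → Finset Expo)
    (hA0 : ∀ j, (0 : Expo) ∉ A j) (huA : ∀ j, (u j).support ⊆ A j) (hvA : ∀ j, (v j).support ⊆ A j)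
    (J : Finset (Fin m)) (a₀ b₀ : Fin m → Expo)
    (hSR : ∀ a ∈ tuples A, ∀ b ∈ tuples A, a ≠ b → ∑ j, a j = ∑ j, b j →
      (∀ j, a j ≠ b j ↔ j ∈ J) ∧ ((∀ j ∈ J, a j = a₀ j ∧ b j = b₀ j) ∨ (∀ j ∈ J, a j = b₀ j ∧ b j = a₀ j)))
    (R : Expo → Expo → Prop) (S : Finset Expo) (hS : IsCellFamily u v R S) :
    S.card ≤ 2 * (m + 1) * (3 * (2 + m + m.choose 2) ^ 2) := by
  have h := planarCell_relationClasses u v A hA0 huA hvA (r := 1) (fun _ => J) (fun _ => a₀) (fun _ => b₀)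
    (fun a ha b hb hne hsum => ⟨0, hSR a ha b hb hne hsum⟩) R S hS
  simpa using h

/-- **`r = 0` of the block law = the dissociated regime.** [folklore] -/
theorem planarCell_relationBlocks_zero (u v : Fin m → MvPolynomial (Fin 2) ℂ) (A : Fin m → Finset Expo)
    (hA0 : ∀ j, (0 : Expo) ∉ A j) (huA : ∀ j, (u j).support ⊆ A j) (hvA : ∀ j, (v j).support ⊆ A j)
    (hdis : Set.InjOn (fun a : Fin m → Expo => ∑ j, a j) ↑(tuples A))
    (R : Expo → Expo → Prop) (S : Finset Expo) (hS : IsCellFamily u v R S) :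
    S.card ≤ 2 * (m + 1) := by
  have h := planarCell_relationBlocks u v A hA0 huA hvA (r := 0) (fun k => k.elim0) (fun k => k.elim0) (fun k => k.elim0)
    (fun a ha b hb hne hsum _ _ => absurd (hdis ha hb hsum) hne) R S hS
  simpa using h

/-- **`r = 1` of the block law = the single-relation law.** [folklore] -/
theorem planarCell_singleRelation_of_relationBlocks (u v : Fin m → MvPolynomial (Fin 2) ℂ) (A : Fin m → Finset Expo)
    (hA0 : ∀ j, (0 : Expo) ∉ A j) (huA : ∀ j, (u j).support ⊆ A j) (hvA : ∀ j, (v j).support ⊆ A j)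
    (J : Finset (Fin m)) (a₀ b₀ : Fin m → Expo)
    (hSR : ∀ a ∈ tuples A, ∀ b ∈ tuples A, a ≠ b → ∑ j, a j = ∑ j, b j →
      (∀ j, a j ≠ b j ↔ j ∈ J) ∧ ((∀ j ∈ J, a j = a₀ j ∧ b j = b₀ j) ∨ (∀ j ∈ J, a j = b₀ j ∧ b j = a₀ j)))
    (R : Expo → Expo → Prop) (S : Finset Expo) (hS : IsCellFamily u v R S) :
    S.card ≤ 2 * (m + 1) * (3 * (2 + m + m.choose 2) ^ 2) := by
  have h := planarCell_relationBlocks u v A hA0 huA hvA (r := 1) (fun _ => J) (fun _ => a₀) (fun _ => b₀)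
    (relationBlocks_of_relationClasses A (fun _ => J) (fun _ => a₀) (fun _ => b₀)
      (fun a ha b hb hne hsum => ⟨0, hSR a ha b hb hne hsum⟩)) R S hS
  simpa using h

end Summit.ValiantsHypothesis.ValiantsHypothesis.Theorems.NewtonUnitEquations.TwoProducts.PlanarCell

end
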